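import Literature.NumberTheory.EllipticCurves.ShintaniGenusSymbolsOdd
import Literature.NumberTheory.EllipticCurves.ShintaniKernelLevel256Law
import HarnessLib

/-!
# The twisted Shintani kernel `K⁻_D` of the odd discriminant `-D` and its level-`256` law

[[cite: Shintani1975, §1 Prop. 1.6, §2 (2.1), (2.12), Thm. 2]] [[cite: Shimura1973HalfIntegral, §1]]
— the tree's twisted kernels `K_D` (`ShintaniKernelPoisson.kerD`, weight
`ω_D = χ₋₄(v₂) ∏_{p ∣ D} Ω_p`, the genus character of the even discriminant `-4D`) vanish identically
for `D ≡ 3 (mod 4)` (`kerD_eq_zero_of_mod_four`), so the class `D ≡ 3 (mod 8)` of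
`Literature.NumberTheory.EllipticCurves.Tunnell1983_a_sq_propto_L_one` (Tunnell's `a(n)`,
`n ≡ 3 (mod 8)`; `L(E_D, 1) = L(φ ⊗ (·/D), 1)`) needs the kernel built on the genus weight of the
ODD discriminant `-D`, `ω⁻_D = ∏_{p ∣ D} Ω_p` (`ShintaniGenusSymbolsOdd.genusWtOdd`).  This file
builds it and PROVES that it obeys the SAME transformation law as `K_D` does for `D ≡ 1 (mod 4)`:

1. `cDOdd`, **`kerDOdd`** `= 𝒦[c⁻_D, 1/(256D)]` (a `genKernel` of `ShintaniKernelLevel64`): bounded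
   `Γ₀(64)`-invariant weight, weight `-2` in `w` (`kerDOdd_sl_smul`), `L`-coordinates
   (`kerDOdd_eq_tsum`), `K⁻_D ≡ 0` for `D ≡ 1 (mod 4)` (`kerDOdd_eq_zero_of_mod_four_eq_one`).
2. **Cone Gauss sums for `w_D` alone** (`coneSum_one`, `coneSum_wD` = `(★G⁻)`:
   `∑_{r ∈ (ℤ/N)³} w_D(r-u) e_N(a n(r)) = w_D(-u) N G(64a; N)`, `N = 256D`, by CRT into the plain
   `2`-adic sum and the tree's `D`-part `dPartProp_all`), the bridge `genusWtOdd_eq_wD`, the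
   off-`L` vanishing `sum_wD_mul_stdAddChar_eq_zero` and the completed square
   `sum_wD_mul_stdAddChar_bZ`.
3. **The Poisson step** `kerDOdd_smul` (the tree's `kerD_smul` verbatim with the weight `w_D`; no
   `4 ∣ c` needed) and **the evaluation at `c = 256`** `kerDOdd_smul_sigma` with the constant
   `𝒦⁻(a, a*) = (-a*/D) · N · G(64a; N)` (`evalConstOdd`, `gaussCoefOdd_embedSharp`).
4. **The level-`256` law** `isThetaAutomorphic_kerDOdd`: `K⁻_D(w, γz) θ(z)³ = θ(γz)³ K⁻_D(w, z)` on
   `Γ₀(256)`, trivial character, for `D` odd square-free (non-trivially for `D ≡ 3 (mod 4)`).  The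
   point: `G(64a; 256D) = 128 (1 + ψ₄(3a)) (a/D) · i√D` for `D ≡ 3 (mod 4)` (CRT, Gauss's sign
   `G(1; D) = i√D`; `quadGaussSum_sixtyfour_mul_three`) and `(-a*/D)(a/D) = (-1/D) = -1`
   (`jacobi_prod_eq_neg_one`) give `𝒦⁻(a, a*) = χ₋₄(-a*) · N · 128 (1 + ψ₄(a)) √D`
   (`evalConstOdd_eq`) — exactly the closed form of the even-case constant —, and the archimedean
   identity with this closed form (`const_identity_core`, the tree's `const_identity` with the
   Jacobi symbols multiplied out) yields the `σ`-law (`kerDOdd_sigma_law`); `T`-law, continuity and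
   the generator argument as in `ShintaniKernelLevel256Law`.  The law was first confirmed
   numerically (ratios `1 ± 10⁻¹²` for `D = 3, 7, 11, 15` at all generators; kit job `j013365`).

Everything is proved; no named facts.  Definitions: `cDOdd`, `kerDOdd`, `gaussCoefOdd`,
`evalConstOdd`.  What remains for the class `3 (mod 8)`: the lift/unfolding/`q`-expansion/
symmetry/diagonal chain of the even case (`ShintaniLift` … `ShintaniSplitOrbitCoefficients`) run
with `kerDOdd` in place of `kerD`.
-/

/-!
## Part — The twisted Shintani kernel `K⁻_D` for the odd discriminant `-D` (`D ≡ 3 (mod 4)`)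

[[cite: Shintani1975, §2 (2.1), (2.12), Thm. 2]] — with the odd-discriminant genus weight
`ω⁻_D = ∏_{p ∣ D} Ω_p` (`ShintaniGenusSymbolsOdd.genusWtOdd`) in place of `ω_D = χ₋₄(v₂) ω⁻_D`:
`cDOdd`, `kerDOdd` — the weight on `L♮ ⊇ L` and **the kernel `K⁻_D = 𝒦[c⁻_D, 1/(256D)]`** as a
`genKernel` (`ShintaniKernelLevel64`): bounded and `Γ₀(64)`-invariant weight (`bddWeight_cDOdd`,
`invWeight_cDOdd`), hence **weight `-2` in `w` under `Γ₀(64)`** (`kerDOdd_sl_smul`), the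
`L`-coordinate expansion (`kerDOdd_eq_tsum`), the parity `c⁻_D(-k) = χ₄(D) c⁻_D(k)` and
`K⁻_D ≡ 0` for `D ≡ 1 (mod 4)` (`kerDOdd_eq_zero_of_mod_four_eq_one`) — complementary to `kerD`
(`≡ 0` for `D ≡ 3 (mod 4)`).  NOT here: the Poisson step / level law in `z` for `K⁻_D` (the `2`-adic
cone Gauss sum changes: the plain `∑_{r mod 256} e(t n(r)/256)` replaces the `χ₋₄`-twisted one of
`ShintaniConeGaussSums`) and everything downstream.  No named facts; definitions `cDOdd`, `kerDOdd`.
-/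


noncomputable section

open Complex Real
open scoped MatrixGroups

namespace Literature.NumberTheory.EllipticCurves.Shintani

open UpperHalfPlane hiding I

/-! ### The weight `c⁻_D` on `L♮` and the kernel `K⁻_D` -/

/-- The weight of the `D`-th odd-discriminant kernel on `L♮`-coordinates: `ω⁻_D` on the sublattice
`L = {128 ∣ k₁}`, `0` elsewhere. [folklore] -/
def cDOdd (D : ℕ) (k : Fin 3 → ℤ) : ℂ :=
  if (128 : ℤ) ∣ k 1 then (genusWtOdd D ![k 0, k 1 / 128, k 2] : ℂ) else 0

/-- `cDOdd_embedSharp` (auxiliary). [folklore] -/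
theorem cDOdd_embedSharp (D : ℕ) (v : Fin 3 → ℤ) : cDOdd D (embedSharp v) = genusWtOdd D v := by
  unfold cDOdd
  rw [if_pos (by simp : (128 : ℤ) ∣ embedSharp v 1)]
  congr 1
  congr 1
  funext i
  fin_cases i <;> simp

/-- `cDOdd_of_not_dvd` (auxiliary). [folklore] -/
theorem cDOdd_of_not_dvd {D : ℕ} {k : Fin 3 → ℤ} (h : ¬ (128 : ℤ) ∣ k 1) : cDOdd D k = 0 := by
  simp [cDOdd, h]

/-- `bddWeight_cDOdd` (auxiliary). [folklore] -/
theorem bddWeight_cDOdd (D : ℕ) : BddWeight (cDOdd D) := by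
  refine ⟨1, fun k ↦ ?_⟩
  unfold cDOdd
  split_ifs
  · rw [Complex.norm_intCast]
    exact_mod_cast abs_genusWtOdd_le D _
  · simp

/-- **`c⁻_D` is `Γ₀(64)`-invariant** (`D` odd). [folklore] -/
theorem invWeight_cDOdd {D : ℕ} (hD : Odd D) : InvWeight (cDOdd D) := by
  intro a b c' d hdet k
  by_cases hk : (128 : ℤ) ∣ k 1
  · obtain ⟨k1, hk1⟩ := hk
    set v : Fin 3 → ℤ := ![k 0, k1, k 2] with hv
    have hkv : k = embedSharp v := by
      funext i; fin_cases i <;> simp [hv, embedSharp, hk1]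
    rw [hkv, actSharp_embedSharp, cDOdd_embedSharp, cDOdd_embedSharp, genusWtOdd_actInt hD hdet]
  · rw [cDOdd_of_not_dvd hk, cDOdd_of_not_dvd ((dvd_actSharp_one_iff hdet k).not.mpr hk)]

/-- The parity of `c⁻_D` on `L♮`: `c⁻_D(-k) = χ₄(D) c⁻_D(k)` (`D` odd square-free). [folklore] -/
theorem cDOdd_neg {D : ℕ} (hD : Squarefree D) (hDodd : Odd D) (k : Fin 3 → ℤ) :
    cDOdd D (-k) = (ZMod.χ₄ D : ℂ) * cDOdd D k := by
  unfold cDOdd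
  have hiff : (128 : ℤ) ∣ (-k) 1 ↔ (128 : ℤ) ∣ k 1 := by simp
  by_cases hk : (128 : ℤ) ∣ k 1
  · rw [if_pos (hiff.mpr hk), if_pos hk]
    have hv : (![(-k) 0, (-k) 1 / 128, (-k) 2] : Fin 3 → ℤ) = -![k 0, k 1 / 128, k 2] := by
      obtain ⟨k1, hk1⟩ := hk
      have e1 : -(128 * k1) / 128 = -k1 := by omega
      funext i
      fin_cases i <;> simp [hk1, e1]
    rw [hv, genusWtOdd_neg hD hDodd]
    push_cast
    ring
  · rw [if_neg (mt hiff.mp hk), if_neg hk, mul_zero]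

/-- **The `D`-th twisted Shintani theta kernel of level `64` for the odd discriminant `-D`**:
`K⁻_D(w, z) = (Im z)^{1/2} ∑_{k ∈ L♮} c⁻_D(k) f_{w, z/(256D)}(ι♮ k)`. [cite: Shintani1975, §2 (2.1), Thm. 2] -/
def kerDOdd (D : ℕ) [NeZero D] (w z : ℍ) : ℂ := genKernel (cDOdd D) (1 / (256 * D)) (scaleD_pos D) w z

/-- A series on `L♮` supported on `L` is a series on `L` (odd-discriminant weight). [folklore] -/
theorem tsum_cDOdd_mul (D : ℕ) (F : V → ℂ) :
    ∑' k : Fin 3 → ℤ, cDOdd D k * F (latSharp k) =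
      ∑' v : Fin 3 → ℤ, (genusWtOdd D v : ℂ) * F (latFun v) := by
  have hsupp : Function.support (fun k : Fin 3 → ℤ ↦ cDOdd D k * F (latSharp k)) ⊆ Set.range embedSharp := by
    intro k hk
    rw [Function.mem_support] at hk
    by_cases h : (128 : ℤ) ∣ k 1
    · obtain ⟨k1, hk1⟩ := h
      exact ⟨![k 0, k1, k 2], by funext i; fin_cases i <;> simp [embedSharp, hk1]⟩
    · exact absurd (by rw [cDOdd_of_not_dvd h, zero_mul]) hk
  rw [← tsum_subtype_eq_of_support_subset hsupp]
  rw [← (Equiv.ofInjective embedSharp embedSharp_injective).tsum_eq]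
  refine tsum_congr fun v ↦ ?_
  simp only [Equiv.ofInjective_apply]
  rw [cDOdd_embedSharp, latSharp_embedSharp]

/-- **`K⁻_D` in `L`-coordinates**: `K⁻_D(w,z) = (Im z)^{1/2} ∑_v ω⁻_D(v) f_{w, z/(256D)}(ι v)`. [folklore] -/
theorem kerDOdd_eq_tsum (D : ℕ) [NeZero D] (w z : ℍ) :
    kerDOdd D w z = (Real.sqrt z.im : ℂ) * ∑' v : Fin 3 → ℤ, (genusWtOdd D v : ℂ) *
      shintaniFn w (mulPos (1 / (256 * D)) (scaleD_pos D) z) (latFun v) := by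
  unfold kerDOdd genKernel
  rw [tsum_cDOdd_mul D _]

/-- **Weight `-2` in `w` under `Γ₀(64)`**: `K⁻_D(γw, z)(c_γ w + d_γ)² = K⁻_D(w, z)` (`D` odd).
[cite: Shintani1975, (2.12)] -/
theorem kerDOdd_sl_smul {D : ℕ} [NeZero D] (hD : Odd D) (γ : SL(2, ℤ)) (hγ : (64 : ℤ) ∣ γ 1 0)
    (w z : ℍ) :
    kerDOdd D (γ • w) z * (((γ 1 0 : ℤ) : ℂ) * w + ((γ 1 1 : ℤ) : ℂ)) ^ 2 = kerDOdd D w z :=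
  genKernel_sl_smul (invWeight_cDOdd hD) _ _ γ hγ w z

/-- **`K⁻_D ≡ 0` for `D ≡ 1 (mod 4)`** (square-free): then `ω⁻_D` is even while the Schwartz function
is odd — complementary to `kerD_eq_zero_of_mod_four` (`K_D ≡ 0` for `D ≡ 3 (mod 4)`). [folklore] -/
theorem kerDOdd_eq_zero_of_mod_four_eq_one {D : ℕ} [NeZero D] (hsq : Squarefree D) (hD : D % 4 = 1)
    (w z : ℍ) : kerDOdd D w z = 0 := by
  have hodd : Odd D := Nat.odd_iff.mpr (by omega)
  have hχ : (ZMod.χ₄ (D : ZMod 4) : ℤ) = 1 := by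
    rw [ZMod.χ₄_nat_mod_four, hD]; decide
  have hs : ∀ k, cDOdd D (-k) = (1 : ℂ) * cDOdd D k := fun k ↦ by
    rw [cDOdd_neg hsq hodd k, hχ]; push_cast; ring
  have h := genKernel_of_weight_neg (bddWeight_cDOdd D) hs (1 / (256 * D)) (scaleD_pos D) w z
  have h2 : (1 + 1 : ℂ) ≠ 0 := by norm_num
  exact (mul_eq_zero.mp h).resolve_left h2

end Literature.NumberTheory.EllipticCurves.Shintani

/-!
## Part — Cone Gauss sums for the odd-discriminant weight `ω⁻_D = ∏_{p ∣ D} Ω_p`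

[[cite: Shintani1975, §1 Prop. 1.6, Thm. 2]] — the arithmetic input of the level-`256` law of the
odd-discriminant twisted Shintani kernel `K⁻_D` (`ShintaniKernelOdd.kerDOdd`, weight
`ShintaniGenusSymbolsOdd.genusWtOdd`; the class `D ≡ 3 (mod 8)` of
`Literature.NumberTheory.EllipticCurves.Tunnell1983_a_sq_propto_L_one`).  On residues the weight is
the tree's `D`-part `w_D` (`ShintaniConeGaussSums.wD`) ALONE — no `2`-adic character — so the cone
Gauss sum `(★G)` of `ShintaniConeGaussSums` is re-proved with the trivial weight at `2`:

* `coneSum_one` — `∑_{r ∈ (ℤ/M)³} e_M(t n(r)) = M · G(64t; M)` (`t` a unit; the `r₀`-sum forces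
  `r₂ = 0`);
* **`coneSum_wD`** — `(★G⁻)`: `∑_{r ∈ (ℤ/N)³} w_D(r - u) e_N(a n(r)) = w_D(-u) · N · G(64a; N)`,
  `N = 256D`, by the CRT factorisation (`coneSum_mul_of_coprime`) into `coneSum_one` and the tree's
  `D`-part `dPartProp_all`;
* `genusWtOdd_eq_wD` (bridge to the integer weight), `wD_add_shift`, and the two consequences fed
  into the Poisson step: off `L` the Gauss coefficient sum VANISHES
  (`sum_wD_mul_stdAddChar_eq_zero`, shift `r₁ ↦ r₁ + 2D`) and on `L` it is the cone Gauss sum after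
  completing the square (`sum_wD_mul_stdAddChar_bZ`).

Everything is proved; no definitions, no named facts.
-/



open Complex Finset

namespace Literature.NumberTheory.EllipticCurves.Shintani

open Literature.NumberTheory.EllipticCurves.ModularForms (quadGaussSum quadGaussSum_def
  quadGaussSum_mul_of_coprime quadGaussSum_unit_sq_mul)

/-! ### The untwisted factor: trivial weight -/

/-- **`∑_{r ∈ (ℤ/M)³} e_M(t n(r)) = M · G(64t; M)`** for a unit `t` (the `r₀`-sum forces `r₂ = 0`,
the `r₁`-sum is the Gauss sum). [folklore] -/
theorem coneSum_one {M : ℕ} [NeZero M] {t : ZMod M} (ht : IsUnit t) :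
    coneSum M (fun _ ↦ (1 : ℂ)) t = M * quadGaussSum M (64 * t) 0 := by
  classical
  rw [coneSum, sum_vecM]
  have inner : ∀ b c : ZMod M, ∑ a : ZMod M, (1 : ℂ) * ZMod.stdAddChar (t * nZ (vecM a b c)) =
      ZMod.stdAddChar (t * (64 * b ^ 2)) * (if c = 0 then (M : ℂ) else 0) := by
    intro b c
    have : ∀ a : ZMod M, t * nZ (vecM a b c) = t * (64 * b ^ 2) + a * (-(t * c)) := by
      intro a; simp only [nZ, vecM_zero, vecM_one, vecM_two]; ring
    simp_rw [one_mul, this, AddChar.map_add_eq_mul]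
    rw [← Finset.mul_sum, AddChar.sum_mulShift _ (ZMod.isPrimitive_stdAddChar M), ZMod.card]
    congr 1
    by_cases hc : c = 0
    · simp [hc]
    · have : -(t * c) ≠ 0 := by
        rw [neg_ne_zero]
        exact (ht.mul_right_eq_zero).not.mpr hc
      simp [hc, this]
  rw [Finset.sum_comm]
  have hbc : ∀ b : ZMod M, ∑ a : ZMod M, ∑ c : ZMod M,
      (1 : ℂ) * ZMod.stdAddChar (t * nZ (vecM a b c)) = ZMod.stdAddChar (t * (64 * b ^ 2)) * M := by
    intro b
    rw [Finset.sum_comm]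
    simp_rw [inner b, mul_ite, mul_zero]
    rw [Finset.sum_ite_eq' Finset.univ (0 : ZMod M), if_pos (Finset.mem_univ _)]
  simp_rw [hbc]
  rw [← Finset.sum_mul, quadGaussSum_def]
  simp_rw [zero_mul, add_zero, show ∀ r : ZMod M, 64 * t * r ^ 2 = t * (64 * r ^ 2) from
    fun r ↦ by ring]
  ring

/-! ### `(★G⁻)`: the cone Gauss sum for `w_D` modulo `N = 256 D` -/

/-- **The cone Gauss sum for the odd-discriminant weight** (`D` odd square-free, `N = 256 D`, `a` a
unit mod `N`, `u ∈ (ℤ/N)³`): `∑_{r ∈ (ℤ/N)³} w_D(r - u) e_N(a · n(r)) = w_D(-u) · N · G(64a; N)`.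
[cite: Shintani1975, §1 Prop. 1.6] -/
theorem coneSum_wD {D : ℕ} [NeZero D] (hsq : Squarefree D) (hodd : Odd D)
    (a : ZMod (256 * D)) (ha : IsUnit a) (u : Fin 3 → ZMod (256 * D)) :
    coneSum (256 * D) (fun r ↦ wD D (r - u)) a =
      wD D (-u) * (256 * D : ℕ) * quadGaussSum (256 * D) (64 * a) 0 := by
  have hcop : Nat.Coprime 256 D := coprime_256_of_odd hodd
  haveI : NeZero (256 * D) := ⟨mul_ne_zero (by norm_num) (NeZero.ne D)⟩
  haveI : NeZero (256 : ℕ) := ⟨by norm_num⟩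
  set π₁ := ZMod.castHom (dvd_mul_right 256 D) (ZMod 256) with hπ₁
  set π₂ := ZMod.castHom (dvd_mul_left D 256) (ZMod D) with hπ₂
  set u₂ : Fin 3 → ZMod D := fun i ↦ π₂ (u i) with hu₂
  set W₁ : (Fin 3 → ZMod 256) → ℂ := fun _ ↦ 1 with hW₁
  set W₂ : (Fin 3 → ZMod D) → ℂ := fun ρ ↦ wD D (ρ - u₂) with hW₂
  -- split the weight (trivial at `2`)
  have hW : (fun r : Fin 3 → ZMod (256 * D) ↦ wD D (r - u)) = fun r ↦
      W₁ (fun i ↦ ZMod.castHom (dvd_mul_right 256 D) (ZMod 256) (r i)) *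
      W₂ (fun i ↦ ZMod.castHom (dvd_mul_left D 256) (ZMod D) (r i)) := by
    funext r
    rw [wD_castHom (dvd_refl D) (dvd_mul_left D 256)]
    simp only [hW₁, hW₂, hu₂, Pi.sub_apply, map_sub, one_mul]
    rfl
  rw [hW, coneSum_mul_of_coprime hcop W₁ W₂ a]
  -- units
  have hDu : IsUnit ((D : ℕ) : ZMod 256) := (ZMod.isUnit_iff_coprime D 256).mpr hcop.symm
  have h256u : IsUnit ((256 : ℕ) : ZMod D) := (ZMod.isUnit_iff_coprime 256 D).mpr hcop
  have hDinv : IsUnit ((D : ZMod 256)⁻¹) := IsUnit.of_mul_eq_one (D : ZMod 256)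
    (ZMod.inv_mul_of_unit _ hDu)
  have h256inv : IsUnit (((256 : ℕ) : ZMod D)⁻¹) := IsUnit.of_mul_eq_one ((256 : ℕ) : ZMod D)
    (ZMod.inv_mul_of_unit _ h256u)
  have ht₁ : IsUnit ((D : ZMod 256)⁻¹ * π₁ a) := hDinv.mul (ha.map _)
  have ht₂ : IsUnit ((((256 : ℕ) : ZMod D))⁻¹ * π₂ a) := h256inv.mul (ha.map _)
  -- the two local sums
  have hS₁ : coneSum 256 W₁ ((D : ZMod 256)⁻¹ * π₁ a) =
      (256 : ℂ) * quadGaussSum 256 (64 * ((D : ZMod 256)⁻¹ * π₁ a)) 0 := by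
    have := coneSum_one (M := 256) ht₁
    rw [hW₁]
    exact_mod_cast this
  have hS₂ : coneSum D W₂ ((((256 : ℕ) : ZMod D))⁻¹ * π₂ a) =
      wD D (-u₂) * D * quadGaussSum D (64 * ((((256 : ℕ) : ZMod D))⁻¹ * π₂ a)) 0 :=
    dPartProp_all D hsq hodd _ ht₂ u₂
  rw [show ((256 : ℕ) : ZMod D) = (256 : ZMod D) by push_cast; rfl] at hS₂
  rw [hS₁]
  erw [hS₂]
  -- right-hand side
  have hw : wD D (-u) = wD D (-u₂) := by
    rw [wD_castHom (dvd_refl D) (dvd_mul_left D 256)]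
    simp only [hu₂, Pi.neg_apply, map_neg]
    rfl
  have hG := quadGaussSum_mul_of_coprime hcop (64 * a.val : ℤ)
  push_cast at hG
  have e0 : (64 : ZMod (256 * D)) * ((a.val : ℕ) : ZMod (256 * D)) = 64 * a := by
    rw [ZMod.natCast_zmod_val]
  have hπ₁a : π₁ a = ((a.val : ℕ) : ZMod 256) := by rw [hπ₁, ZMod.castHom_apply, ZMod.cast_eq_val]
  have hπ₂a : π₂ a = ((a.val : ℕ) : ZMod D) := by rw [hπ₂, ZMod.castHom_apply, ZMod.cast_eq_val]
  have ea : (D : ZMod 256) * (64 * ((a.val : ℕ) : ZMod 256)) =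
      (D : ZMod 256) ^ 2 * ((D : ZMod 256)⁻¹ * π₁ a) * 64 := by
    rw [hπ₁a]
    have : (D : ZMod 256) * (D : ZMod 256)⁻¹ = 1 := ZMod.mul_inv_of_unit _ hDu
    linear_combination (-(64 * ((a.val : ℕ) : ZMod 256) * (D : ZMod 256))) * this
  have h256u' : IsUnit (256 : ZMod D) := by have := h256u; push_cast at this; exact this
  have eb : (256 : ZMod D) * (64 * ((a.val : ℕ) : ZMod D)) =
      (256 : ZMod D) ^ 2 * ((256 : ZMod D)⁻¹ * π₂ a) * 64 := by
    rw [hπ₂a]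
    have : (256 : ZMod D) * (256 : ZMod D)⁻¹ = 1 := ZMod.mul_inv_of_unit _ h256u'
    linear_combination (-(64 * ((a.val : ℕ) : ZMod D) * (256 : ZMod D))) * this
  rw [e0, ea, eb, mul_assoc ((D : ZMod 256) ^ 2), mul_assoc ((256 : ZMod D) ^ 2),
    quadGaussSum_unit_sq_mul hDu, quadGaussSum_unit_sq_mul h256u'] at hG
  rw [hw, hG, mul_comm (64 : ZMod 256), mul_comm (64 : ZMod D)]
  push_cast
  ring

/-- **Bridge to the integer weight**: for `D ∣ M`, `genusWtOdd D v = w_D(v mod M)`. [folklore] -/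
theorem genusWtOdd_eq_wD {D M : ℕ} [NeZero M] (hDM : D ∣ M) (v : Fin 3 → ℤ) :
    (genusWtOdd D v : ℂ) = wD D (fun i ↦ (v i : ZMod M)) := by
  unfold genusWtOdd wD
  congr 1
  refine Finset.prod_congr rfl fun p hp ↦ ?_
  haveI : NeZero p := ⟨(Nat.prime_of_mem_primeFactors hp).ne_zero⟩
  have hpM : p ∣ M := dvd_trans (Nat.dvd_of_mem_primeFactors hp) hDM
  rw [coneSym_eq_coneSymZ p v]
  congr 2
  funext i
  rw [ZMod.cast_intCast hpM]

/-- `w_D` does not see `r₁` beyond `n`: shifting `r₁` by `2D` changes neither `w_D` nor `n (mod N)`.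
[folklore] -/
theorem wD_add_shift {D : ℕ} [NeZero D] (r : Fin 3 → ZMod (256 * D)) :
    wD D (r + fun i ↦ if i = 1 then (2 * D : ZMod (256 * D)) else 0) = wD D r := by
  unfold wD
  congr 1
  refine Finset.prod_congr rfl fun p hp ↦ ?_
  have hpD : p ∣ D := Nat.dvd_of_mem_primeFactors hp
  congr 1
  funext i
  simp only [Pi.add_apply]
  split_ifs with hi
  · subst hi
    rw [ZMod.cast_add (dvd_mul_of_dvd_right hpD 256), show ((2 * D : ZMod (256 * D))).cast =
      (ZMod.castHom (dvd_mul_of_dvd_right hpD 256) (ZMod p)) (2 * D) from rfl, map_mul, map_natCast,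
      (ZMod.natCast_eq_zero_iff D p).mpr hpD, mul_zero, add_zero]
  · rw [add_zero]

/-- **Off `L` the Gauss coefficient sum vanishes** (`N = 256D`, `128 ∤ k₁`):
`∑_{r mod N} w_D(r) ψ_N(a n(r) + ℓ(r, k)) = 0`. [folklore] -/
theorem sum_wD_mul_stdAddChar_eq_zero {D : ℕ} [NeZero D] (a : ZMod (256 * D))
    (k : Fin 3 → ℤ) (hk : ¬ (128 : ℤ) ∣ k 1) :
    ∑ r : Fin 3 → ZMod (256 * D), wD D r * ZMod.stdAddChar (a * nZ r + ellZ r k) = 0 := by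
  set sh : Fin 3 → ZMod (256 * D) := fun i ↦ if i = 1 then (2 * D : ZMod (256 * D)) else 0 with hsh
  set S := ∑ r : Fin 3 → ZMod (256 * D), wD D r * ZMod.stdAddChar (a * nZ r + ellZ r k) with hS
  set F : (Fin 3 → ZMod (256 * D)) → ℂ := fun r ↦ wD D r * ZMod.stdAddChar (a * nZ r + ellZ r k)
    with hF
  have hshift : S = ZMod.stdAddChar ((2 * D : ZMod (256 * D)) * (k 1 : ZMod (256 * D))) * S := by
    have h1 : S = ∑ r : Fin 3 → ZMod (256 * D), F (r + sh) :=
      (Fintype.sum_equiv (Equiv.addRight sh) (fun r ↦ F (r + sh)) F (fun _ ↦ rfl)).symm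
    conv_lhs => rw [h1]
    rw [hS, Finset.mul_sum]
    refine Finset.sum_congr rfl fun r _ ↦ ?_
    rw [hF]
    dsimp only
    rw [hsh, wD_add_shift, nZ_add_shift, ellZ_add_shift, ← add_assoc, AddChar.map_add_eq_mul]
    ring
  have hne : (ZMod.stdAddChar ((2 * D : ZMod (256 * D)) * (k 1 : ZMod (256 * D))) : ℂ) ≠ 1 := by
    have := stdAddChar_shift_ne_one (D := D) hk
    push_cast at this ⊢
    exact this
  have : (1 - ZMod.stdAddChar ((2 * D : ZMod (256 * D)) * (k 1 : ZMod (256 * D)))) * S = 0 := by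
    linear_combination hshift
  rcases mul_eq_zero.mp this with h | h
  · exact absurd (sub_eq_zero.mp h).symm hne
  · exact h

/-- **On `L` the Gauss coefficient sum is a cone Gauss sum** (`N = 256D`, `aa' = 1`):
`∑_r w_D(r) ψ_N(a n(r) + B(r, u)) = ψ_N(-a' n(u)) · w_D(-a'u) · N · G(64a; N)`. [folklore] -/
theorem sum_wD_mul_stdAddChar_bZ {D : ℕ} [NeZero D] (hsq : Squarefree D) (hodd : Odd D)
    (a a' : ZMod (256 * D)) (haa' : a * a' = 1) (u : Fin 3 → ZMod (256 * D)) :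
    ∑ r : Fin 3 → ZMod (256 * D), wD D r * ZMod.stdAddChar (a * nZ r + bZ r u) =
      ZMod.stdAddChar (-(a' * nZ u)) * (wD D (-(a' • u)) * (256 * D : ℕ) *
        quadGaussSum (256 * D) (64 * a) 0) := by
  have ha : IsUnit a := IsUnit.of_mul_eq_one a' haa'
  have key : ∀ r : Fin 3 → ZMod (256 * D),
      a * nZ r + bZ r u = a * nZ (r + a' • u) + -(a' * nZ u) := by
    intro r
    rw [nZ_add, bZ_smul_right, nZ_smul]
    linear_combination (-(bZ r u) - a' * nZ u) * haa'
  simp_rw [key, AddChar.map_add_eq_mul]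
  rw [← coneSum_wD hsq hodd a ha (a' • u), coneSum, Finset.mul_sum]
  refine Fintype.sum_equiv (Equiv.addRight (a' • u)) _ _ fun r ↦ ?_
  simp only [Equiv.coe_addRight, add_sub_cancel_right]
  ring

end Literature.NumberTheory.EllipticCurves.Shintani

/-!
## Part — The Poisson step for the odd-discriminant kernel `K⁻_D` and its evaluation at `c = 256`

[[cite: Shintani1975, §1 Prop. 1.6, §2 (2.1)]] — the twin of `ShintaniKernelPoisson` for the
kernel `K⁻_D = 𝒦[c⁻_D, 1/(256D)]` of `ShintaniKernelOdd` (weight `ω⁻_D = ∏_{p ∣ D} Ω_p`, the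
genus character of the odd discriminant `-D`; the class `D ≡ 3 (mod 8)` of
`Literature.NumberTheory.EllipticCurves.Tunnell1983_a_sq_propto_L_one`):

* `gaussCoefOdd` and **the Poisson step** `kerDOdd_smul`: for `γ = (a b; c d) ∈ SL₂(ℤ)`, `c > 0`,
  `N = cD` (no `4 ∣ c` needed),
  `K⁻_D(w, γz) = (Im γz)^{1/2} (8192N³)⁻¹ κ(Z') (128N)⁻¹ ∑_k 𝔊⁻_γ(k) f_{w, z/(256D)}(ι♮ k)` with
  `𝔊⁻_γ(k) = e(d·disc ι♮k/(256N)) ∑_{r mod N} w_D(r) ψ_N(a n(r) + ℓ(r,k))` — the proof of the tree's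
  `kerD_smul` verbatim with the weight `w_D` (no `2`-adic character; only `D ∣ N` is used);
* **the evaluation at `c = 256`** (`kerDOdd_smul_sigma`): by `ShintaniConeGaussSumsOdd` the Gauss
  coefficient vanishes off `L` and equals `𝒦⁻(a,a*) ω⁻_D(v)` on `L` (`gaussCoefOdd_embedSharp`,
  `𝒦⁻(a, a*) = (-a*/D) · N · G(64a; N)`), so the kernel reproduces itself up to the constant
  `(8192N³)⁻¹ κ(Z') (128N)⁻¹ 𝒦⁻(a, a*) (Im z)^{-1/2}`.

Everything is proved; the definitions are `gaussCoefOdd`, `evalConstOdd`.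
-/



open Complex Real
open scoped MatrixGroups

namespace Literature.NumberTheory.EllipticCurves.Shintani

open UpperHalfPlane hiding I

section Pieces

variable (D : ℕ) [NeZero D]

/-- **The Gauss coefficient** of the transformed odd kernel:
`𝔊⁻_γ(k) = e(d · disc ι♮(k)/(256N)) · ∑_{r ∈ (ℤ/N)³} w_D(r) ψ_N(a n(r) + ℓ(r, k))`, `N = cD`. [folklore] -/
def gaussCoefOdd (a d : ℤ) (c : ℕ) [NeZero c] (k : Fin 3 → ℤ) : ℂ :=
  eR (d * disc (latSharp k) / (256 * (c * D : ℕ))) *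
    ∑ r : Fin 3 → ZMod (c * D), wD D r * ZMod.stdAddChar ((a : ZMod (c * D)) * nZ r + ellZ r k)

omit [NeZero D] in
/-- `|w_D(r)| ≤ 1` on residues. [folklore] -/
theorem norm_wD_le {M : ℕ} (r : Fin 3 → ZMod M) : ‖wD D r‖ ≤ 1 := by
  unfold wD
  rw [← Complex.ofReal_intCast, Complex.norm_real, Real.norm_eq_abs, Int.cast_prod, Finset.abs_prod]
  refine Finset.prod_le_one (fun _ _ ↦ abs_nonneg _) fun p _ ↦ ?_
  unfold coneSymZ
  exact_mod_cast abs_coneSym_le p _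

/-- `|𝔊⁻_γ(k)| ≤ N³`: the Gauss coefficients are bounded. [folklore] -/
theorem bddWeight_gaussCoefOdd (a d : ℤ) (c : ℕ) [NeZero c] :
    BddWeight (gaussCoefOdd D a d c) := by
  refine ⟨(Fintype.card (Fin 3 → ZMod (c * D)) : ℝ), fun k ↦ ?_⟩
  unfold gaussCoefOdd
  rw [norm_mul, norm_eR, one_mul]
  refine (norm_sum_le _ _).trans ?_
  have : ∀ r : Fin 3 → ZMod (c * D),
      ‖wD D r * ZMod.stdAddChar ((a : ZMod (c * D)) * nZ r + ellZ r k)‖ ≤ 1 := fun r ↦ by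
    rw [norm_mul, AddChar.norm_apply, mul_one]
    exact norm_wD_le D r
  calc ∑ r : Fin 3 → ZMod (c * D), ‖wD D r * ZMod.stdAddChar ((a : ZMod (c * D)) * nZ r + ellZ r k)‖
      ≤ ∑ _r : Fin 3 → ZMod (c * D), (1 : ℝ) := Finset.sum_le_sum fun r _ ↦ this r
    _ = _ := by simp

/-- `ω⁻_D(Nq + r̃) = ω⁻_D(r̃)` (`D ∣ N`). [folklore] -/
theorem genusWtOdd_splitEquiv {D N : ℕ} [NeZero N] (hD : D ∣ N) (q : Fin 3 → ℤ)
    (r : Fin 3 → ZMod N) : genusWtOdd D (splitEquiv N (q, r)) = genusWtOdd D (liftZ r) := by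
  refine genusWtOdd_congr (M := N) (by exact_mod_cast hD) fun i ↦ ?_
  rw [splitEquiv_apply, liftZ]
  exact (Int.modEq_iff_dvd.mpr ⟨-q i, by ring⟩)

open Literature.NumberTheory.LFunctions.Fourier (summable_one_add_norm_rpow_neg) in
omit [NeZero D] in
/-- Summability of the `L`-families `v ↦ ω⁻_D(v) u(v) f_{w,Z}(ι v)` for bounded `u`. [folklore] -/
theorem summable_L_family_odd (u : (Fin 3 → ℤ) → ℂ) (hu : ∀ v, ‖u v‖ ≤ 1) (w Z : ℍ) :
    Summable fun v : Fin 3 → ℤ ↦ (genusWtOdd D v : ℂ) * u v * shintaniFn w Z (latFun v) := by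
  obtain ⟨C', hC'⟩ := norm_term_le (bddWeight_cDOdd D) w Z
  refine Summable.of_norm_bounded ((summable_one_add_norm_rpow_neg (ι := Fin 3) (b := 4)
    (by norm_num)).mul_left C') fun v ↦ ?_
  have h := hC' (embedSharp v)
  rw [cDOdd_embedSharp, latSharp_embedSharp] at h
  have hC0 : 0 ≤ C' := by
    have h0 := hC' 0
    have e0 : (fun i : Fin 3 ↦ (((0 : Fin 3 → ℤ) i : ℤ) : ℝ)) = 0 := by funext i; simp
    rw [e0, norm_zero, add_zero, Real.one_rpow, mul_one] at h0
    exact le_trans (norm_nonneg _) h0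
  calc ‖(genusWtOdd D v : ℂ) * u v * shintaniFn w Z (latFun v)‖
      = ‖u v‖ * ‖(genusWtOdd D v : ℂ) * shintaniFn w Z (latFun v)‖ := by
        rw [norm_mul, norm_mul, norm_mul]; ring
    _ ≤ 1 * (C' * (1 + ‖fun i ↦ ((embedSharp v i : ℤ) : ℝ)‖) ^ (-(4 : ℝ))) :=
        mul_le_mul (hu v) h (norm_nonneg _) zero_le_one
    _ ≤ 1 * (C' * (1 + ‖fun i ↦ ((v i : ℤ) : ℝ)‖) ^ (-(4 : ℝ))) := by
        refine mul_le_mul_of_nonneg_left (mul_le_mul_of_nonneg_left ?_ hC0) zero_le_one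
        · apply Real.rpow_le_rpow_of_nonpos (by positivity) ?_ (by norm_num)
          gcongr
          refine (pi_norm_le_iff_of_nonneg (norm_nonneg _)).mpr fun i ↦ ?_
          refine le_trans ?_ (norm_le_pi_norm (fun i ↦ ((embedSharp v i : ℤ) : ℝ)) i)
          rw [Real.norm_eq_abs, Real.norm_eq_abs]
          fin_cases i <;> simp [embedSharp, abs_mul]
          nlinarith [abs_nonneg ((v 1 : ℤ) : ℝ)]
    _ = _ := one_mul _

open Literature.NumberTheory.EllipticCurves.ModularForms (det_eq_one') in
/-- **The Poisson step for `K⁻_D`.** For `γ = (a b; c d) ∈ SL₂(ℤ)` with `c > 0`, `N = cD` (no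
divisibility of `c` by `4` is needed: the weight has no `2`-adic component):
`K⁻_D(w, γz) = (Im γz)^{1/2} (8192N³)⁻¹ κ(Z') (128N)⁻¹ ∑_{k ∈ ℤ³} 𝔊⁻_γ(k) f_{w, z/(256D)}(ι♮(k))`,
`Z' = -1/(256N(cz+d))`. [cite: Shintani1975, Prop. 1.6] -/
theorem kerDOdd_smul (γ : SL(2, ℤ)) (c : ℕ) [NeZero c] (hc : (γ 1 0 : ℤ) = c) (w z : ℍ) :
    kerDOdd D w (γ • z) = (Real.sqrt (γ • z).im : ℂ) *
      ((((8192 * ((c * D : ℕ) : ℝ) ^ 3)⁻¹ : ℝ) : ℂ) * kappa (invFour (auxW (c * D) c (γ 1 1) z)) *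
        (((128 * (c * D : ℕ) : ℝ) : ℂ))⁻¹) *
      ∑' k : Fin 3 → ℤ, gaussCoefOdd D (γ 0 0) (γ 1 1) c k *
        shintaniFn w (ptD D z) (latSharp k) := by
  set N : ℕ := c * D with hN
  set a : ℤ := γ 0 0 with ha
  set d : ℤ := γ 1 1 with hd
  have hDN : D ∣ c * D := dvd_mul_left D c
  have hNpos : (0 : ℝ) < (c * D : ℕ) := by exact_mod_cast Nat.pos_of_ne_zero (NeZero.ne (c * D))
  set Z' : ℍ := invFour (auxW (c * D) c d z) with hZ'
  rw [kerDOdd_eq_tsum, mul_assoc]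
  congr 1
  -- Step A: the point identity and the phase `e(a n(v)/N)`
  have hP : ptD D (γ • z) = ((a / (256 * D * c) : ℝ)) +ᵥ Z' := mulPos_smul_eq_vadd D γ c hc z
  have hA : ∀ v : Fin 3 → ℤ, (genusWtOdd D v : ℂ) * shintaniFn w (ptD D (γ • z)) (latFun v) =
      (genusWtOdd D v : ℂ) * eR (a * nQ v / (c * D : ℕ)) * shintaniFn w Z' (latFun v) := by
    intro v
    rw [hP, shintaniFn_vadd, disc_latFun, eR]
    conv_rhs => rw [mul_assoc]
    congr 2
    congr 1
    have hc0 : (c : ℂ) ≠ 0 := by exact_mod_cast NeZero.ne c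
    have hD0 : (D : ℂ) ≠ 0 := by exact_mod_cast NeZero.ne D
    push_cast
    field_simp
  simp_rw [hA]
  -- Step B: reindex `v = Nq + r̃`
  set F : (Fin 3 → ℤ) → ℂ := fun v ↦ (genusWtOdd D v : ℂ) * eR (a * nQ v / (c * D : ℕ)) *
    shintaniFn w Z' (latFun v) with hF
  have hFs : Summable F := summable_L_family_odd D (fun v ↦ eR (a * nQ v / (c * D : ℕ)))
    (fun v ↦ (norm_eR _).le) w Z'
  set e : (Fin 3 → ZMod N) × (Fin 3 → ℤ) ≃ (Fin 3 → ℤ) :=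
    (Equiv.prodComm _ _).trans (splitEquiv N) with he
  have he_apply : ∀ r q, e (r, q) = splitEquiv N (q, r) := fun r q ↦ rfl
  have hFe : Summable (F ∘ e) := (e.summable_iff).mpr hFs
  rw [show ∑' v, F v = ∑' p : (Fin 3 → ZMod N) × (Fin 3 → ℤ), (F ∘ e) p from (e.tsum_eq F).symm,
    hFe.tsum_prod' (fun r ↦ hFe.prod_factor r), tsum_fintype]
  simp only [Function.comp_apply]
  -- Step C: each residue class
  have hC : ∀ r : Fin 3 → ZMod N, ∑' q : Fin 3 → ℤ, F (e (r, q)) =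
      (genusWtOdd D (liftZ r) : ℂ) * eR (a * nQ (liftZ r) / (c * D : ℕ)) *
        ((((8192 * ((c * D : ℕ) : ℝ) ^ 3)⁻¹ : ℝ) : ℂ) * kappa Z' * (((128 * (c * D : ℕ) : ℝ) : ℂ))⁻¹ *
        ∑' k : Fin 3 → ℤ,
          eR (((-(liftZ r 0) * k 2 + liftZ r 1 * k 1 - liftZ r 2 * k 0 : ℤ) : ℝ) / (c * D : ℕ)) *
          eR (d * disc (latSharp k) / (256 * (c * D : ℕ))) *
          shintaniFn w (ptD D z) (latSharp k)) := by
    intro r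
    have h1 : ∀ q, F (e (r, q)) = (genusWtOdd D (liftZ r) : ℂ) * eR (a * nQ (liftZ r) / (c * D : ℕ)) *
        shintaniFn w Z' (dgLin (muN N) (WithLp.toLp 2 fun i ↦ (q i : ℝ)) + latFun (liftZ r)) := by
      intro q
      rw [he_apply, hF]
      dsimp only
      rw [genusWtOdd_splitEquiv hDN, latFun_splitEquiv]
      obtain ⟨m, hm⟩ := nQ_splitEquiv N q r
      rw [hm]
      congr 2
      push_cast
      have hNR : (N : ℝ) = (c : ℝ) * D := by rw [hN]; push_cast; ring
      have hc0 : (c : ℝ) ≠ 0 := by exact_mod_cast NeZero.ne c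
      have hD0 : (D : ℝ) ≠ 0 := by exact_mod_cast NeZero.ne D
      have : (a : ℝ) * ((nQ (liftZ r) : ℝ) + (N : ℝ) * m) / ((c : ℝ) * D) =
          (a : ℝ) * (nQ (liftZ r)) / ((c : ℝ) * D) + ((a * m : ℤ) : ℝ) := by
        rw [hNR]; push_cast; field_simp
      rw [this, eR_add_int]
    simp_rw [h1]
    rw [tsum_mul_left, tsum_q_residue D c d w z r]
  simp_rw [hC]
  -- Step D: swap the finite `r`-sum and the `k`-sum, collect `𝔊⁻`
  have hk_summ : ∀ r : Fin 3 → ZMod N, Summable fun k : Fin 3 → ℤ ↦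
      eR (((-(liftZ r 0) * k 2 + liftZ r 1 * k 1 - liftZ r 2 * k 0 : ℤ) : ℝ) / (c * D : ℕ)) *
      eR (d * disc (latSharp k) / (256 * (c * D : ℕ))) * shintaniFn w (ptD D z) (latSharp k) := by
    intro r
    have := summable_term (c := fun k ↦
      eR (((-(liftZ r 0) * k 2 + liftZ r 1 * k 1 - liftZ r 2 * k 0 : ℤ) : ℝ) / (c * D : ℕ)) *
      eR (d * disc (latSharp k) / (256 * (c * D : ℕ)))) ⟨1, fun k ↦ by
        rw [norm_mul, norm_eR, norm_eR, one_mul]⟩ w (ptD D z)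
    exact this
  have hrk : ∀ (r : Fin 3 → ZMod N) (k : Fin 3 → ℤ),
      (genusWtOdd D (liftZ r) : ℂ) * eR (a * nQ (liftZ r) / (c * D : ℕ)) *
        eR (((-(liftZ r 0) * k 2 + liftZ r 1 * k 1 - liftZ r 2 * k 0 : ℤ) : ℝ) / (c * D : ℕ)) =
      wD D r * ZMod.stdAddChar ((a : ZMod (c * D)) * nZ r + ellZ r k) := by
    intro r k
    rw [mul_assoc, ← eR_add, genusWtOdd_eq_wD hDN (liftZ r)]
    have hl : ∀ i, (((liftZ r i : ℤ)) : ZMod (c * D)) = r i := fun i ↦ by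
      rw [liftZ, Int.cast_natCast, ZMod.natCast_zmod_val]
    congr 1
    · congr 1; funext i; exact hl i
    · rw [show (a : ℝ) * (nQ (liftZ r) : ℝ) / (c * D : ℕ) +
          ((-(liftZ r 0) * k 2 + liftZ r 1 * k 1 - liftZ r 2 * k 0 : ℤ) : ℝ) / (c * D : ℕ) =
          ((a * nQ (liftZ r) + (-(liftZ r 0) * k 2 + liftZ r 1 * k 1 - liftZ r 2 * k 0) : ℤ) : ℝ) /
            (c * D : ℕ) by push_cast; ring, eR_div_eq_stdAddChar]
      congr 1
      unfold nQ nZ ellZ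
      push_cast
      rw [hl 0, hl 1, hl 2]
      ring
  set C : ℂ := (((8192 * ((c * D : ℕ) : ℝ) ^ 3)⁻¹ : ℝ) : ℂ) * kappa Z' *
    (((128 * (c * D : ℕ) : ℝ) : ℂ))⁻¹ with hCdef
  set A : (Fin 3 → ZMod N) → (Fin 3 → ℤ) → ℂ := fun r k ↦
    eR (((-(liftZ r 0) * k 2 + liftZ r 1 * k 1 - liftZ r 2 * k 0 : ℤ) : ℝ) / (c * D : ℕ)) *
      eR (d * disc (latSharp k) / (256 * (c * D : ℕ))) * shintaniFn w (ptD D z) (latSharp k) with hAdef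
  set ω : (Fin 3 → ZMod N) → ℂ := fun r ↦ (genusWtOdd D (liftZ r) : ℂ) * eR (a * nQ (liftZ r) / (c * D : ℕ))
    with hωdef
  show ∑ r : Fin 3 → ZMod N, ω r * (C * ∑' k, A r k) = C * ∑' k, gaussCoefOdd D a d c k *
    shintaniFn w (ptD D z) (latSharp k)
  calc ∑ r : Fin 3 → ZMod N, ω r * (C * ∑' k, A r k)
      = C * ∑ r : Fin 3 → ZMod N, ∑' k, ω r * A r k := by
        rw [Finset.mul_sum]
        refine Finset.sum_congr rfl fun r _ ↦ ?_
        rw [tsum_mul_left]; ring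
    _ = C * ∑' k, ∑ r : Fin 3 → ZMod N, ω r * A r k := by
        rw [Summable.tsum_finsetSum (fun r _ ↦ (hk_summ r).mul_left (ω r))]
    _ = C * ∑' k, gaussCoefOdd D a d c k * shintaniFn w (ptD D z) (latSharp k) := by
        congr 1
        refine tsum_congr fun k ↦ ?_
        rw [gaussCoefOdd, Finset.mul_sum, Finset.sum_mul]
        refine Finset.sum_congr rfl fun r _ ↦ ?_
        rw [hωdef, hAdef]
        dsimp only
        rw [← hrk r k]
        ring

end Pieces

/-! ### Evaluation at `c = 256`: the kernel reproduces itself -/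

section Eval256

variable (D : ℕ) [NeZero D]

/-- Off `L` the Gauss coefficient vanishes (`c = 256`). [folklore] -/
theorem gaussCoefOdd_of_not_dvd (a d : ℤ) {k : Fin 3 → ℤ} (hk : ¬ (128 : ℤ) ∣ k 1) :
    gaussCoefOdd D a d 256 k = 0 := by
  unfold gaussCoefOdd
  rw [show ((a : ℤ) : ZMod (256 * D)) = (a : ZMod (256 * D)) from rfl,
    sum_wD_mul_stdAddChar_eq_zero (a : ZMod (256 * D)) k hk, mul_zero]

/-- The constant of the `c = 256` evaluation for the odd weight:
`𝒦⁻(a, a*) = J(-a* | D) · N · G(64a; N)`, `N = 256D`, `aa* ≡ 1 (mod N)` (no `χ₄(-a*)`: the weight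
has no `2`-adic component). [folklore] -/
def evalConstOdd (a a' : ℤ) : ℂ :=
  (jacobiSym (-a') D : ℂ) * (256 * D : ℕ) *
    Literature.NumberTheory.EllipticCurves.ModularForms.quadGaussSum (256 * D) (64 * (a : ZMod (256 * D))) 0

/-- **On `L` the Gauss coefficient reproduces the weight** (`c = 256`, `D` odd square-free,
`aa* ≡ 1 (mod 256D)`, `d ≡ a* (mod 256)`): `𝔊⁻_σ(embed v) = 𝒦⁻(a,a*) ω⁻_D(v)`. [folklore] -/
theorem gaussCoefOdd_embedSharp (hsq : Squarefree D) (hodd : Odd D) (a a' d : ℤ)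
    (haa' : (a : ZMod (256 * D)) * (a' : ZMod (256 * D)) = 1) (hda : (256 : ℤ) ∣ d - a') (v : Fin 3 → ℤ) :
    gaussCoefOdd D a d 256 (embedSharp v) = evalConstOdd D a a' * genusWtOdd D v := by
  have hDN : D ∣ 256 * D := dvd_mul_left D 256
  unfold gaussCoefOdd
  simp_rw [ellZ_embedSharp]
  rw [sum_wD_mul_stdAddChar_bZ hsq hodd (a : ZMod (256 * D)) (a' : ZMod (256 * D)) haa'
    (fun i ↦ (v i : ZMod (256 * D)))]
  -- the weight at `-(a* • v)`
  have hw : wD D (-((a' : ZMod (256 * D)) • fun i ↦ (v i : ZMod (256 * D)))) =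
      (jacobiSym (-a') D : ℂ) * genusWtOdd D v := by
    have e : (-((a' : ZMod (256 * D)) • fun i ↦ (v i : ZMod (256 * D)))) =
        fun i ↦ ((((-a') • v) i : ℤ) : ZMod (256 * D)) := by
      funext i; simp [Pi.smul_apply, smul_eq_mul]
    rw [e, ← genusWtOdd_eq_wD hDN, genusWtOdd_smul hsq]
    push_cast
    ring
  rw [hw, latSharp_embedSharp, disc_latFun]
  by_cases hv : genusWtOdd D v = 0
  · simp [hv]
  · have hDn : (D : ℤ) ∣ nQ v := by
      by_contra h; exact hv (genusWtOdd_of_not_dvd hsq h)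
    have hphase : eR (d * (256 * (nQ v : ℝ)) / (256 * (256 * D : ℕ))) *
        (ZMod.stdAddChar (-((a' : ZMod (256 * D)) * nZ fun i ↦ (v i : ZMod (256 * D)))) : ℂ) = 1 := by
      have e1 : (d : ℝ) * (256 * (nQ v : ℝ)) / (256 * (256 * D : ℕ)) = ((d * nQ v : ℤ) : ℝ) / (256 * D : ℕ) := by
        have : ((256 * D : ℕ) : ℝ) ≠ 0 := by exact_mod_cast NeZero.ne (256 * D)
        push_cast; field_simp
      have e2 : (nZ fun i ↦ (v i : ZMod (256 * D))) = ((nQ v : ℤ) : ZMod (256 * D)) := by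
        unfold nZ nQ; push_cast; ring
      rw [e1, eR_div_eq_stdAddChar, e2, ← AddChar.map_add_eq_mul]
      have : ((d * nQ v : ℤ) : ZMod (256 * D)) + -((a' : ZMod (256 * D)) * ((nQ v : ℤ) : ZMod (256 * D))) = 0 := by
        obtain ⟨m, hm⟩ := hDn
        obtain ⟨e, he⟩ := hda
        have : (d * nQ v - a' * nQ v : ℤ) = (256 * D : ℕ) * (e * m) := by
          rw [← sub_mul, he, hm]; push_cast; ring
        have h0 : ((d * nQ v - a' * nQ v : ℤ) : ZMod (256 * D)) = 0 := by
          rw [this, Int.cast_mul, Int.cast_natCast, ZMod.natCast_self, zero_mul]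
        push_cast at h0 ⊢
        linear_combination h0
      rw [this, AddChar.map_zero_eq_one]
    unfold evalConstOdd
    linear_combination ((jacobiSym (-a') D : ℂ) * genusWtOdd D v * (256 * D : ℕ) *
      Literature.NumberTheory.EllipticCurves.ModularForms.quadGaussSum (256 * D)
        (64 * (a : ZMod (256 * D))) 0) * hphase

/-- A series of Gauss coefficients against `ι♮` collapses to the weight series against `ι`. [folklore] -/
theorem tsum_gaussCoefOdd_mul (hsq : Squarefree D) (hodd : Odd D) (a a' d : ℤ)
    (haa' : (a : ZMod (256 * D)) * (a' : ZMod (256 * D)) = 1) (hda : (256 : ℤ) ∣ d - a')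
    (F : V → ℂ) :
    ∑' k : Fin 3 → ℤ, gaussCoefOdd D a d 256 k * F (latSharp k) =
      evalConstOdd D a a' * ∑' v : Fin 3 → ℤ, (genusWtOdd D v : ℂ) * F (latFun v) := by
  have hsupp : Function.support (fun k : Fin 3 → ℤ ↦ gaussCoefOdd D a d 256 k *
      F (latSharp k)) ⊆ Set.range embedSharp := by
    intro k hk
    rw [Function.mem_support] at hk
    by_cases h : (128 : ℤ) ∣ k 1
    · obtain ⟨k1, hk1⟩ := h
      exact ⟨![k 0, k1, k 2], by funext i; fin_cases i <;> simp [embedSharp, hk1]⟩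
    · exact absurd (by rw [gaussCoefOdd_of_not_dvd D a d h, zero_mul]) hk
  rw [← tsum_subtype_eq_of_support_subset hsupp,
    ← (Equiv.ofInjective embedSharp embedSharp_injective).tsum_eq, ← tsum_mul_left]
  refine tsum_congr fun v ↦ ?_
  simp only [Equiv.ofInjective_apply]
  rw [gaussCoefOdd_embedSharp D hsq hodd a a' d haa' hda, latSharp_embedSharp]
  ring

/-- **The odd kernel reproduces itself under `σ = (a b; 256 d)`** (`D` odd square-free,
`aa* ≡ 1 (mod 256D)`):
`K⁻_D(w, σz) = (Im σz)^{1/2} (8192N³)⁻¹ κ(Z') (128N)⁻¹ 𝒦⁻(a,a*) (Im z)^{-1/2} K⁻_D(w, z)`. [folklore] -/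
theorem kerDOdd_smul_sigma (hsq : Squarefree D) (hodd : Odd D) (σ : SL(2, ℤ)) (hc : (σ 1 0 : ℤ) = 256)
    (a' : ℤ) (haa' : ((σ 0 0 : ℤ) : ZMod (256 * D)) * (a' : ZMod (256 * D)) = 1) (w z : ℍ) :
    kerDOdd D w (σ • z) = (Real.sqrt (σ • z).im : ℂ) *
      ((((8192 * ((256 * D : ℕ) : ℝ) ^ 3)⁻¹ : ℝ) : ℂ) * kappa (invFour (auxW (256 * D) 256 (σ 1 1) z)) *
        (((128 * (256 * D : ℕ) : ℝ) : ℂ))⁻¹) *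
      (evalConstOdd D (σ 0 0) a' * ((Real.sqrt z.im : ℂ))⁻¹ * kerDOdd D w z) := by
  have hda : (256 : ℤ) ∣ (σ 1 1 : ℤ) - a' := by
    have hdet := Literature.NumberTheory.EllipticCurves.ModularForms.det_eq_one' σ
    rw [hc] at hdet
    have h1 : ((σ 0 0 : ℤ) : ZMod 256) * ((σ 1 1 : ℤ) : ZMod 256) = 1 := by
      have := congrArg (fun x : ℤ ↦ (x : ZMod 256)) hdet
      push_cast at this
      have h256 : (256 : ZMod 256) = 0 := by decide
      rw [h256, mul_zero, sub_zero] at this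
      exact this
    have h2 : ((σ 0 0 : ℤ) : ZMod 256) * ((a' : ℤ) : ZMod 256) = 1 := by
      have := congrArg (ZMod.castHom (dvd_mul_right 256 D) (ZMod 256)) haa'
      rw [map_mul, map_one, map_intCast, map_intCast] at this
      exact this
    have hu : IsUnit ((σ 0 0 : ℤ) : ZMod 256) := IsUnit.of_mul_eq_one _ h1
    have h3 : ((σ 1 1 : ℤ) : ZMod 256) = ((a' : ℤ) : ZMod 256) := by
      have := hu.mul_left_cancel (h1.trans h2.symm)
      exact this
    have h4 : (((σ 1 1 : ℤ) - a' : ℤ) : ZMod 256) = 0 := by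
      push_cast
      rw [h3, sub_self]
    exact_mod_cast (ZMod.intCast_zmod_eq_zero_iff_dvd _ 256).mp h4
  haveI : NeZero (256 : ℕ) := ⟨by norm_num⟩
  rw [kerDOdd_smul D σ 256 hc w z]
  congr 1
  rw [tsum_gaussCoefOdd_mul D hsq hodd (σ 0 0) a' (σ 1 1) haa' hda _, kerDOdd_eq_tsum]
  have hz : (Real.sqrt z.im : ℂ) ≠ 0 := by
    exact_mod_cast (Real.sqrt_pos.mpr z.im_pos).ne'
  field_simp

end Eval256

end Literature.NumberTheory.EllipticCurves.Shintani

/-!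
## Part — The level-`256` transformation law of the odd-discriminant kernel `K⁻_D` (`D ≡ 3 (mod 4)`)

[[cite: Shintani1975, Prop. 1.6]] [[cite: Shimura1973HalfIntegral, §1]] — for `D ≡ 3 (mod 4)`
square-free, `z ↦ K⁻_D(w, z)` (`ShintaniKernelOdd.kerDOdd`, weight `ω⁻_D = ∏_{p ∣ D} Ω_p`, the genus
character of the odd discriminant `-D`) satisfies the SAME law as the tree's `K_D` does for
`D ≡ 1 (mod 4)`: the `θ`-multiplier law of weight `3/2` on `Γ₀(256)` with trivial character,
`K⁻_D(w, γz) θ(z)³ = θ(γz)³ K⁻_D(w, z)` (`isThetaAutomorphic_kerDOdd`; for `D ≡ 1 (mod 4)` the odd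
kernel vanishes identically).  This is the kernel serving the class `D ≡ 3 (mod 8)` of
`Literature.NumberTheory.EllipticCurves.Tunnell1983_a_sq_propto_L_one`; the law was first
confirmed numerically (ratios `1 ± 10⁻¹²` for `D = 3, 7, 11, 15` at the generators, kit job
`j013365` of the seat's folder) and is proved here.

Proof.  As in `ShintaniKernelLevel256Law`: generators `T`, `-1`, `σ = (a b; 256 d)` with
`gcd(a, D) = 1`; the `T`-law is the integrality `n(v)/D ∈ ℤ` on the support of `ω⁻_D`; for `σ`,
`kerDOdd_smul_sigma` (`ShintaniKernelPoissonOdd`) produces the constant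
`𝒦⁻(a, a*) = (-a*/D) · N · G(64a; N)`, and the point is that it EQUALS the even-case constant in
closed form: with `G(64a; 256D) = 128 (1 + ψ₄(3a)) (a/D) · i√D` (CRT, `(D mod 4) = 3`, Gauss's sign
`G(1; D) = i√D`, `quadGaussSum_sixtyfour_mul_three`) and `(-a*/D)(a/D) = (-1/D) = -1`
(`jacobi_prod_eq_neg_one`) one gets `𝒦⁻(a,a*) = χ₋₄(-a*) · N · 128 (1 + ψ₄(a)) √D`
(`evalConstOdd_eq`) — the same closed form as for `K_D`, `D ≡ 1 (mod 4)`.  The archimedean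
identity with this closed form (`const_identity_core`, the tree's `const_identity` with the
Jacobi symbols already multiplied out) then gives the `σ`-law (`kerDOdd_sigma_law`).

Everything is proved; no definitions, no named facts.
-/



open Complex Real
open scoped MatrixGroups ComplexConjugate

namespace Literature.NumberTheory.EllipticCurves.Shintani

open UpperHalfPlane hiding I
open Literature.NumberTheory.EllipticCurves.ModularForms
open Literature.NumberTheory.EllipticCurves.Tunnell1983 (thetaMul_one_eq_shimuraTheta thetaMul_one_smul)

/-! ### Gauss sums for `D ≡ 3 (mod 4)` -/

/-- `G(64a; 256D) = 128 (1 + ψ₄(3a)) (a/D) · i√D` for `D ≡ 3 (mod 4)` square-free-or-not odd with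
`gcd(a, D) = 1` (CRT, scaling `G(64aD; 256) = 64 G(3a; 4)`, unit squares, `G(a; D) = (a/D) G(1; D)`,
Gauss's sign `G(1; D) = i√D`). [folklore] -/
theorem quadGaussSum_sixtyfour_mul_three (D : ℕ) [NeZero D] (hD3 : D % 4 = 3) {a : ℤ}
    (haD : a.gcd D = 1) :
    quadGaussSum (256 * D) (64 * (a : ZMod (256 * D))) 0 =
      128 * (1 + (ZMod.stdAddChar ((3 : ZMod 4) * (a : ZMod 4)) : ℂ)) * jacobiSym a D *
        (I * (Real.sqrt D : ℂ)) := by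
  have hodd : Odd D := Nat.odd_iff.mpr (by omega)
  have h2D : Nat.Coprime 2 D := Nat.coprime_two_left.mpr hodd
  have hcop : Nat.Coprime 256 D := by
    have := Nat.Coprime.pow_left 8 h2D
    norm_num at this
    exact this
  have e0 : (64 * (a : ZMod (256 * D))) = ((64 * a : ℤ) : ZMod (256 * D)) := by push_cast; ring
  rw [e0, quadGaussSum_mul_of_coprime hcop (64 * a)]
  -- first factor
  have f1 : quadGaussSum 256 (((D : ℤ) * (64 * a) : ℤ) : ZMod 256) 0 =
      64 * (2 + 2 * (ZMod.stdAddChar ((3 : ZMod 4) * (a : ZMod 4)) : ℂ)) := by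
    have h := quadGaussSum_mul_mul (c := 256) (t := 64) (m := 4) (by norm_num) (D * a)
    have e : (((64 : ℕ) : ℤ) * (D * a) : ℤ) = ((D : ℤ) * (64 * a) : ℤ) := by push_cast; ring
    rw [e] at h
    rw [h, quadGaussSum_four_eq]
    have hD4 : ((D : ℕ) : ZMod 4) = 3 := by
      rw [← ZMod.natCast_mod D 4, hD3]; rfl
    push_cast
    rw [hD4]
  -- second factor
  have f2 : quadGaussSum D ((((256 : ℕ) : ℤ) * (64 * a) : ℤ) : ZMod D) 0 =
      jacobiSym a D * (I * (Real.sqrt D : ℂ)) := by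
    have hu : IsUnit ((128 : ℕ) : ZMod D) := by
      rw [ZMod.isUnit_iff_coprime]
      have := Nat.Coprime.pow_left 7 h2D
      norm_num at this
      exact this
    have : ((((256 : ℕ) : ℤ) * (64 * a) : ℤ) : ZMod D) = ((128 : ℕ) : ZMod D) ^ 2 * (a : ZMod D) := by
      push_cast; ring
    rw [this, quadGaussSum_unit_sq_mul hu, quadGaussSum_eq_jacobiSym_mul hodd haD,
      quadGaussSum_one_of_mod_four_eq_three hD3]
  rw [f1, f2]
  ring

/-- `(-a*/D)(a/D) = -1` for `a a* ≡ 1 (mod D)`, `D ≡ 3 (mod 4)`. [folklore] -/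
theorem jacobi_prod_eq_neg_one {D : ℕ} (hD3 : D % 4 = 3) {a a' : ℤ}
    (hDm : ((a * a' : ℤ) : ZMod D) = 1) :
    (jacobiSym (-a') D : ℤ) * jacobiSym a D = -1 := by
  have hodd : Odd D := Nat.odd_iff.mpr (by omega)
  rw [← jacobiSym.mul_left]
  have hmod : (-a' * a : ℤ) ≡ -1 [ZMOD D] := by
    have h1 : (a * a' : ℤ) ≡ 1 [ZMOD D] := by
      rw [← ZMod.intCast_eq_intCast_iff]
      push_cast at hDm ⊢
      exact hDm
    have := h1.neg
    rw [show -(a * a') = -a' * a by ring] at this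
    exact this
  rw [jacobiSym.mod_left, hmod, ← jacobiSym.mod_left, jacobiSym.at_neg_one hodd,
    ZMod.χ₄_nat_mod_four, hD3]
  decide

/-- `ψ₄(3a) = ψ₄(a)³`. [folklore] -/
theorem stdAddChar_three_mul (a : ZMod 4) :
    (ZMod.stdAddChar ((3 : ZMod 4) * a) : ℂ) = (ZMod.stdAddChar a : ℂ) ^ 3 := by
  rw [show (3 : ZMod 4) * a = 3 • a by rw [nsmul_eq_mul]; norm_num, AddChar.map_nsmul_eq_pow]

/-- **The odd constant in closed form** (`D ≡ 3 (mod 4)`, `gcd(a, D) = 1`, `a` odd,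
`a a* ≡ 1 (mod 4)` and `(mod D)`):
`𝒦⁻(a, a*) = χ₋₄(-a*) · N · 128 (1 + ψ₄(a)) √D` — the same closed form as the even-case constant
`𝒦(a, a*)` for `D ≡ 1 (mod 4)`. [folklore] -/
theorem evalConstOdd_eq (D : ℕ) [NeZero D] (hD3 : D % 4 = 3) {a a' : ℤ} (haD : a.gcd D = 1)
    (ha : Odd a) (h4 : (a : ZMod 4) * (a' : ZMod 4) = 1) (hDm : ((a * a' : ℤ) : ZMod D) = 1) :
    evalConstOdd D a a' = ((ZMod.χ₄ (-a' : ℤ) : ℤ) : ℂ) * (256 * D : ℕ) *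
      (128 * (1 + (ZMod.stdAddChar (a : ZMod 4) : ℂ)) * (Real.sqrt D : ℂ)) := by
  have hJ : ((jacobiSym (-a') D : ℤ) : ℂ) * jacobiSym a D = -1 := by
    exact_mod_cast jacobi_prod_eq_neg_one hD3 hDm
  rw [evalConstOdd, quadGaussSum_sixtyfour_mul_three D hD3 haD, stdAddChar_three_mul]
  rcases chars_mod_four ha h4 with ⟨hψ, hχ⟩ | ⟨hψ, hχ⟩
  · rw [hψ, hχ]
    linear_combination (128 * ((256 * D : ℕ) : ℂ) * (Real.sqrt D : ℂ) * I * (1 + I ^ 3)) * hJ +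
      (128 * ((256 * D : ℕ) : ℂ) * (Real.sqrt D : ℂ) * (1 - I ^ 2)) * Complex.I_sq
  · rw [hψ, hχ]
    linear_combination (128 * ((256 * D : ℕ) : ℂ) * (Real.sqrt D : ℂ) * I * (1 - I ^ 3)) * hJ +
      (-(128 * ((256 * D : ℕ) : ℂ) * (Real.sqrt D : ℂ) * (1 - I ^ 2))) * Complex.I_sq

/-! ### The archimedean identity with the closed-form constant -/

section Law

variable (D : ℕ) [NeZero D]

/-- **The constant identity, core form** (any `D ≥ 1`, `a` odd, `a a* ≡ 1 (mod 4)`): with the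
closed-form constant `χ₋₄(-a*) · N · 128 (1 + ψ₄(a)) √D` in place of `𝒦(a, a*)`, the constant
produced by the Poisson step equals the cube of the `θ`-multiplier (the tree's `const_identity`
with the Jacobi symbols multiplied out; valid for both parities of `(D-1)/2`). [folklore] -/
theorem const_identity_core {a a' d : ℤ} (ha : Odd a) (h4 : (a : ZMod 4) * (a' : ZMod 4) = 1) (z : ℍ) :
    (Real.sqrt (z.im / Complex.normSq (w1 d z)) : ℂ) *
        ((((8192 * ((256 * D : ℕ) : ℝ) ^ 3)⁻¹ : ℝ) : ℂ) * kappa (invFour (auxW (256 * D) 256 d z)) *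
          (((128 * (256 * D : ℕ) : ℝ) : ℂ))⁻¹) *
        (((ZMod.χ₄ (-a' : ℤ) : ℤ) : ℂ) * (256 * D : ℕ) *
          (128 * (1 + (ZMod.stdAddChar (a : ZMod 4) : ℂ)) * (Real.sqrt D : ℂ)) * ((Real.sqrt z.im : ℂ))⁻¹) =
      (1 / (2 * I * ((256 : ℕ) : ℂ) / (((256 : ℕ) : ℂ) * z + d)) ^ (1 / 2 : ℂ) *
        quadGaussSum 256 a 0) ^ 3 := by
  -- atoms
  have hw0 := w1_ne_zero d z
  have hn0 : (0 : ℝ) < Complex.normSq (w1 d z) := Complex.normSq_pos.mpr hw0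
  set ρ : ℝ := Real.sqrt (Complex.normSq (w1 d z)) with hρ
  have hρ0 : 0 < ρ := Real.sqrt_pos.mpr hn0
  set β : ℂ := (I * conj (w1 d z)) ^ (1 / 2 : ℂ) with hβdef
  have hβ : β ≠ 0 := beta_ne_zero d z
  set sD : ℝ := Real.sqrt D with hsD
  have hD0 : (0 : ℝ) < D := by exact_mod_cast Nat.pos_of_ne_zero (NeZero.ne D)
  have hsD0 : 0 < sD := Real.sqrt_pos.mpr hD0
  have hsDsq : ((sD : ℂ)) ^ 2 = D := by rw [hsD]; exact_mod_cast Real.sq_sqrt hD0.le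
  set sy : ℝ := Real.sqrt z.im with hsy
  have hsy0 : 0 < sy := Real.sqrt_pos.mpr z.im_pos
  have hs2 : (0 : ℝ) < Real.sqrt 2 := Real.sqrt_pos.mpr (by norm_num)
  have hs2sq : ((Real.sqrt 2 : ℂ)) ^ 2 = 2 := by exact_mod_cast Real.sq_sqrt (by norm_num : (0:ℝ) ≤ 2)
  -- the pieces
  have hκ := kappa_Z'_mul D d z
  have hsM : Real.sqrt (256 * (256 * D : ℕ)) = 256 * sD := by
    rw [show ((256 * (256 * D : ℕ) : ℝ)) = 256 ^ 2 * D by push_cast; ring,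
      Real.sqrt_mul (by norm_num), Real.sqrt_sq (by norm_num)]
  rw [hsM] at hκ
  have hκ' : kappa (invFour (auxW (256 * D) 256 d z)) =
      -(((256 * (256 * D : ℕ) : ℝ) : ℂ)) ^ 2 * ((256 * sD : ℝ) : ℂ) * w1 d z *
        (Complex.normSq (w1 d z) : ℂ) / (8 * (Real.sqrt 2 : ℂ) * β) := by
    rw [eq_div_iff (by
      refine mul_ne_zero (mul_ne_zero (by norm_num) ?_) hβ
      exact_mod_cast hs2.ne')]
    exact hκ
  have him : Real.sqrt (z.im / Complex.normSq (w1 d z)) = sy / ρ := by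
    rw [Real.sqrt_div' _ hn0.le]
  have hnsq : ((Complex.normSq (w1 d z) : ℝ) : ℂ) = (ρ : ℂ) ^ 2 := by
    rw [hρ]; exact_mod_cast (Real.sq_sqrt (Complex.normSq_nonneg _)).symm
  have hR := rho_sq_eq d z
  rw [← hρ, ← hβdef] at hR
  rw [him, hκ', quadGaussSum_256_of_odd ha, thetaFactor_sigma, hnsq, ← hρ, ← hβdef]
  rcases chars_mod_four ha h4 with ⟨hψ, hχ⟩ | ⟨hψ, hχ⟩
  · rw [hψ, hχ]
    push_cast
    have hρ0' : (ρ : ℂ) ≠ 0 := by exact_mod_cast hρ0.ne'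
    have hsy0' : (sy : ℂ) ≠ 0 := by exact_mod_cast hsy0.ne'
    have hs20 : (Real.sqrt 2 : ℂ) ≠ 0 := by exact_mod_cast hs2.ne'
    have hsD0' : (sD : ℂ) ≠ 0 := by exact_mod_cast hsD0.ne'
    have hD0' : (D : ℂ) ≠ 0 := by exact_mod_cast hD0.ne'
    field_simp
    linear_combination (65536 * (sD : ℂ) ^ 2 * w1 d z * β ^ 2 * (I + 1)) * hs2sq +
      (131072 * w1 d z * β ^ 2 * (I + 1)) * hsDsq +
      (-(D : ℂ) * (196608 * I + 196608 * I ^ 2 + 65536 * I ^ 3 + 65536)) * hR +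
      ((D : ℂ) * w1 d z * β ^ 2 * (65536 * I ^ 2 + 196608 * I + 131072)) * Complex.I_sq
  · rw [hψ, hχ]
    push_cast
    have hρ0' : (ρ : ℂ) ≠ 0 := by exact_mod_cast hρ0.ne'
    have hsy0' : (sy : ℂ) ≠ 0 := by exact_mod_cast hsy0.ne'
    have hs20 : (Real.sqrt 2 : ℂ) ≠ 0 := by exact_mod_cast hs2.ne'
    have hsD0' : (sD : ℂ) ≠ 0 := by exact_mod_cast hsD0.ne'
    have hD0' : (D : ℂ) ≠ 0 := by exact_mod_cast hD0.ne'
    field_simp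
    linear_combination (65536 * (sD : ℂ) ^ 2 * w1 d z * β ^ 2 * (I - 1)) * hs2sq +
      (131072 * w1 d z * β ^ 2 * (I - 1)) * hsDsq +
      ((D : ℂ) * (196608 * I - 196608 * I ^ 2 + 65536 * I ^ 3 - 65536)) * hR +
      ((D : ℂ) * w1 d z * β ^ 2 * (-65536 * I ^ 2 + 196608 * I - 131072)) * Complex.I_sq

/-- **The constant identity for the odd kernel at `σ = (a b; 256 d)`** (`D ≡ 3 (mod 4)`,
`gcd(a, D) = 1`, `a a* ≡ 1 (mod 4D)`): the constant produced by the Poisson step equals the cube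
of the `θ`-multiplier. [folklore] -/
theorem const_identity_odd (hD3 : D % 4 = 3) {a a' d : ℤ} (haD : a.gcd D = 1) (ha : Odd a)
    (h4 : (a : ZMod 4) * (a' : ZMod 4) = 1) (hDm : ((a * a' : ℤ) : ZMod D) = 1) (z : ℍ) :
    (Real.sqrt (z.im / Complex.normSq (w1 d z)) : ℂ) *
        ((((8192 * ((256 * D : ℕ) : ℝ) ^ 3)⁻¹ : ℝ) : ℂ) * kappa (invFour (auxW (256 * D) 256 d z)) *
          (((128 * (256 * D : ℕ) : ℝ) : ℂ))⁻¹) *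
        (evalConstOdd D a a' * ((Real.sqrt z.im : ℂ))⁻¹) =
      (1 / (2 * I * ((256 : ℕ) : ℂ) / (((256 : ℕ) : ℂ) * z + d)) ^ (1 / 2 : ℂ) *
        quadGaussSum 256 a 0) ^ 3 := by
  rw [evalConstOdd_eq D hD3 haD ha h4 hDm]
  exact const_identity_core D ha h4 z

end Law

/-! ### Assembly: the `σ`-law, the `T`-law, continuity, automorphy -/

section Assembly

variable (D : ℕ) [NeZero D]

open CongruenceSubgroup

/-- **The `σ`-law for `K⁻_D`**: `K⁻_D(w, σz) θ(z)³ = θ(σz)³ K⁻_D(w, z)` for `σ = (a b; 256 d)` with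
`gcd(a, D) = 1` (`D ≡ 3 (mod 4)` square-free). [cite: Shintani1975, Prop. 1.6] -/
theorem kerDOdd_sigma_law (hsq : Squarefree D) (hD3 : D % 4 = 3) (σ : SL(2, ℤ))
    (hc : (σ 1 0 : ℤ) = 256) (haD : (σ 0 0 : ℤ).gcd D = 1) (w z : ℍ) :
    kerDOdd D w (σ • z) * shimuraTheta z ^ 3 = shimuraTheta (σ • z) ^ 3 * kerDOdd D w z := by
  have hodd : Odd D := Nat.odd_iff.mpr (by omega)
  have hdet := det_eq_one' σ
  rw [hc] at hdet
  have ha : Odd (σ 0 0 : ℤ) := by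
    by_contra h
    rw [Int.not_odd_iff_even] at h
    obtain ⟨k, hk⟩ := h
    rw [hk] at hdet
    have : (2 : ℤ) ∣ 1 := ⟨k * σ 1 1 - σ 0 1 * 128, by linear_combination (-1 : ℤ) * hdet⟩
    omega
  -- `a*` modulo `256 D`
  have hcopZ : IsCoprime (σ 0 0 : ℤ) ((256 * D : ℕ) : ℤ) := by
    have h2 : IsCoprime (σ 0 0 : ℤ) 2 := by
      obtain ⟨k, hk⟩ := ha
      exact ⟨1, -k, by rw [hk]; ring⟩
    have h256 : IsCoprime (σ 0 0 : ℤ) ((2 : ℤ) ^ 8) := h2.pow_right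
    have hD : IsCoprime (σ 0 0 : ℤ) (D : ℤ) := Int.isCoprime_iff_gcd_eq_one.mpr haD
    have := h256.mul_right hD
    push_cast
    norm_num at this
    exact this
  have hunit : IsUnit ((σ 0 0 : ℤ) : ZMod (256 * D)) := by
    rw [ZMod.coe_int_isUnit_iff_isCoprime]; exact hcopZ.symm
  obtain ⟨u, hu⟩ := hunit
  set a' : ℤ := (((u⁻¹ : (ZMod (256 * D))ˣ) : ZMod (256 * D)).val : ℤ) with ha'
  have haa' : ((σ 0 0 : ℤ) : ZMod (256 * D)) * (a' : ZMod (256 * D)) = 1 := by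
    rw [ha', Int.cast_natCast, ZMod.natCast_zmod_val, ← hu, Units.mul_inv]
  have h4 : ((σ 0 0 : ℤ) : ZMod 4) * (a' : ZMod 4) = 1 := by
    have := congrArg (ZMod.castHom (show 4 ∣ 256 * D from dvd_mul_of_dvd_left (by norm_num) D)
      (ZMod 4)) haa'
    rw [map_mul, map_one, map_intCast, map_intCast] at this
    exact this
  have hDm : (((σ 0 0 : ℤ) * a' : ℤ) : ZMod D) = 1 := by
    have := congrArg (ZMod.castHom (dvd_mul_left D 256) (ZMod D)) haa'
    rw [map_mul, map_one, map_intCast, map_intCast] at this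
    push_cast
    exact this
  haveI : NeZero (256 : ℕ) := ⟨by norm_num⟩
  have hK := kerDOdd_smul_sigma D hsq hodd σ hc a' haa' w z
  have hθ : shimuraTheta (σ • z) =
      1 / (2 * I * ((256 : ℕ) : ℂ) / (((256 : ℕ) : ℂ) * z + (σ 1 1 : ℤ))) ^ (1 / 2 : ℂ) *
        quadGaussSum 256 (σ 0 0 : ℤ) 0 * shimuraTheta z := by
    rw [← thetaMul_one_eq_shimuraTheta, ← thetaMul_one_eq_shimuraTheta]
    exact thetaMul_one_smul hc (by norm_num) z
  have him : (σ • z).im = z.im / Complex.normSq (w1 (σ 1 1) z) := by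
    rw [ModularGroup.im_smul_eq_div_normSq, ModularGroup.denom_apply]
    congr 2
    rw [w1, hc]
    push_cast
    ring
  have hstar := const_identity_odd D hD3 (d := σ 1 1) haD ha h4 hDm z
  rw [hK, hθ, him]
  linear_combination (kerDOdd D w z * shimuraTheta z ^ 3) * hstar

/-- **The `T`-law**: `K⁻_D(w, z + 1) = K⁻_D(w, z)` (`D` square-free): on the support of the weight
the exponents `disc ι♮(k)/(256D) = n(v)/D` are integers. [folklore] -/
theorem kerDOdd_T_smul (hsq : Squarefree D) (w z : ℍ) :
    kerDOdd D w (ModularGroup.T • z) = kerDOdd D w z := by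
  rw [UpperHalfPlane.modular_T_smul]
  unfold kerDOdd
  apply genKernel_vadd_of_int
  intro k hk
  by_cases h128 : (128 : ℤ) ∣ k 1
  · obtain ⟨k1, hk1⟩ := h128
    have hke : k = embedSharp ![k 0, k1, k 2] := by
      funext i; fin_cases i <;> simp [embedSharp, hk1]
    rw [hke, cDOdd_embedSharp] at hk
    have hne : genusWtOdd D ![k 0, k1, k 2] ≠ 0 := fun h0 ↦ by apply hk; rw [h0]; simp
    have hDn : (D : ℤ) ∣ nQ ![k 0, k1, k 2] := by
      by_contra h; exact hne (genusWtOdd_of_not_dvd hsq h)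
    obtain ⟨m, hm⟩ := hDn
    refine ⟨m, ?_⟩
    rw [hke, latSharp_embedSharp, disc_latFun, hm]
    have hD0 : (D : ℝ) ≠ 0 := by exact_mod_cast NeZero.ne D
    push_cast
    field_simp
  · exact absurd (cDOdd_of_not_dvd h128) hk

/-- Continuity of `z ↦ K⁻_D(w, z)`. [folklore] -/
theorem continuous_kerDOdd (w : ℍ) : Continuous fun z : ℍ ↦ kerDOdd D w z :=
  continuous_genKernel (bddWeight_cDOdd D) _ _ w

/-- **Automorphy of the odd-discriminant twisted Shintani kernel**: for `D` odd and square-free,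
`z ↦ K⁻_D(w, z)` satisfies the `θ`-multiplier law of weight `3/2` on `Γ₀(256)` with trivial
character (non-trivially for `D ≡ 3 (mod 4)`; for `D ≡ 1 (mod 4)` the kernel is `0`).
[cite: Shintani1975, Prop. 1.6] -/
theorem isThetaAutomorphic_kerDOdd (hsq : Squarefree D) (hodd : Odd D) (w : ℍ) :
    IsThetaAutomorphic 3 256 1 (fun z ↦ kerDOdd D w z) := by
  have hχ : ∀ {x : ZMod 256}, IsUnit x → (1 : DirichletCharacter ℂ 256) x = 1 :=
    fun hx ↦ MulChar.one_apply hx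
  rcases Nat.odd_mod_four_iff.mp (Nat.odd_iff.mp hodd) with h1 | h3
  · intro γ _ z
    simp only [kerDOdd_eq_zero_of_mod_four_eq_one hsq h1, zero_mul, mul_zero]
  · refine isThetaAutomorphic_of_generators (continuous_kerDOdd D w) (genSetD D) ?_
      (gamma0_le_closure_genSetD D hodd) ?_
    · intro σ hσ
      simp only [genSetD, Set.mem_union, Set.mem_singleton_iff, Set.mem_setOf_eq] at hσ
      simp only [SetLike.mem_coe, Gamma0_mem]
      rcases hσ with (rfl | rfl) | ⟨h10, _⟩
      · simp [ModularGroup.T]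
      · simp
      · rw [h10]
        decide
    · intro σ hσ z
      simp only [genSetD, Set.mem_union, Set.mem_singleton_iff, Set.mem_setOf_eq] at hσ
      rcases hσ with (rfl | rfl) | ⟨h10, h00⟩
      · -- `T`
        simp only
        rw [kerDOdd_T_smul D hsq, shimuraTheta_T_smul]
        have : ((ModularGroup.T 1 1 : ℤ) : ZMod 256) = 1 := by simp [ModularGroup.T]
        rw [this, map_one]; ring
      · -- `-1`
        simp only
        rw [show ((-1 : SL(2, ℤ)) • z) = z from by rw [ModularGroup.SL_neg_smul, one_smul]]
        have : (((-1 : SL(2, ℤ)) 1 1 : ℤ) : ZMod 256) = -1 := by simp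
        rw [this, hχ isUnit_one.neg]; ring
      · -- `σ`
        simp only
        have hdet := det_eq_one' σ
        rw [h10] at hdet
        have hd : IsUnit ((σ 1 1 : ℤ) : ZMod 256) := by
          rw [ZMod.coe_int_isUnit_iff_isCoprime]
          refine ⟨-(σ 0 1 : ℤ), σ 0 0, ?_⟩
          push_cast
          linear_combination hdet
        rw [hχ hd, one_mul]
        exact kerDOdd_sigma_law D hsq h3 σ h10 h00 w z

end Assembly

end Literature.NumberTheory.EllipticCurves.Shintani
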